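import Mathlib
import HarnessLib
import Literature.MathematicalPhysics.StatisticalMechanics.RenormalisationMapFreeHtKernelSecondDiffWeak
import Literature.MathematicalPhysics.StatisticalMechanics.AbkmPackageLargeSetMargin
import Literature.MathematicalPhysics.StatisticalMechanics.AbkmPackageLineSecondPairSupplier
import Summits.HubbardSuperconductivity.HubbardSuperconductivity.Theorems.ComplexGFFStiffnessPolynomialGeometricAbsorption
import Literature.MathematicalPhysics.StatisticalMechanics.AbkmPackageLargeSetSlack
import Literature.MathematicalPhysics.StatisticalMechanics.AbkmPackageLocalSlots
import Literature.MathematicalPhysics.StatisticalMechanics.RenormalisationMapBallActivityABKMQ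
import Summits.HubbardSuperconductivity.HubbardSuperconductivity.Theorems.ComplexGFFStiffnessHolomorphicPackageLines

/-!
# Crux child `TwoKernelSkBound` (stmt-HubbardSuperconductivity-27414), line `banach_two_kernel`, stub `stub_blockB4` —
# block B4 on LINES at PACKAGE level: the kernel second difference of `K_{k+1}` along `p, p+y, p+2y` at the fixed
# intermediate Hamiltonian `H̃_{q₀}`, `N`-free

Route `route-HubbardSuperconductivity-ComplexGFFStiffness`, cruxes stmt-…-19154 `HypACumulant` / stmt-…-19155 `HypALocalTwoPoint`;
memo `Cruxes/HypACumulant/TWOKERNEL-PLAN-27414-v3.md` §2 (R4).  For every [ABKM19] package `P` with `0 < P.r` there is an `N`-FREE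
`l₄ ≥ 0` such that at every height, for `q₀, p, p+y, p+y+y` in the tuning ball, every step `k + 1 ≤ N` and every state `(u, v)` in
the `P.r`-ball, with `G_ρ = nextK(μ_ρ; e^{−toHam u}, e^{−H̃_{q₀}}, mulExt v)`, `H̃_{q₀} = nextH D_{q₀} (toHam u) (mulExt v)`:
`‖G_{p+y+y} − G_{p+y} − G_{p+y} + G_p‖_{k+1}^{(A)} ≤ l₄ |y|₁ |y|₁ max(‖u‖, c_v)`.
Package discharge of the kernel-level four-kernel bound `weakNormLE_nextK_freeHt_kernelSecondDiff_abkm_of_stepKernelBounds` (p835118)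
with the line supplier `PackageData.exists_lineSecondPairSupplier` (Lemma 8.4 at `ℓ = 2` along lines, near-`U` form), the room
`κ(r)/κ_mid` and the geometric absorption of the near-`U` polynomial — verbatim the discharge pattern of block U2
(`…FreeHtKernelPair`).  The registered PARALLELOGRAM stub `stub_blockB4` follows from this line form by the predicate subdivision lemma
(`SecondDifferencePredicateBilinear`).  All proved, no `sorry`.  Honest scope: rung route (stiffness of a complex Gaussian gradient field
via the [ABKM19] RG); nothing about superconductivity in the Hubbard model.

## References
* S. Adams, S. Buchholz, R. Kotecký, S. Müller, arXiv:1910.13564, Theorem 6.8, Lemma 8.4, Ch. 12 (12.4), Lemma 12.6 (12.53)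
  [AdamsBuchholzKoteckyMuller2019].
-/

noncomputable section

-- `Summit.<Summit>.<Problem>`: single-conjunct summit, the duplicate component is mandated (D-0017).
set_option linter.dupNamespace false

namespace Summit.HubbardSuperconductivity.HubbardSuperconductivity.Theorems.ComplexGFF

open scoped BigOperators
open Finset
open Literature.MathematicalPhysics.StatisticalMechanics.GradientRG
open Literature.MathematicalPhysics.StatisticalMechanics.TorusPolymer
  (IsPolymer blockOf blocks numBlocks thicken reblock card_blocks_eq_numBlocks)
open Literature.Barriers.CriticalPhenomena.LongRangePhi4.Polymer (IsConn)
open Literature.MathematicalPhysics.StatisticalMechanics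
open Literature.MathematicalPhysics.QuantumFieldTheory

variable {d : ℕ}

/-- `3^{n+1}(2(Lu + c₀))^n·λ^u ≤ 3^{n+1}(2L)^n C₁` when `(u + c₀)^n λ^u ≤ C₁` (plumbing: the near-`U` polynomial of the line supplier is
absorbed by the geometric room). -/
private theorem poly_mul_geom_le_blockB4 {L n : ℕ} {c₀ lamR C₁ : ℝ} (hL1 : 1 ≤ L) (hc₀ : 0 ≤ c₀)
    (hlam0 : 0 ≤ lamR) (hC₁ : ∀ m : ℕ, ((m : ℝ) + c₀) ^ n * lamR ^ m ≤ C₁) (u : ℕ) :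
    (3 : ℝ) ^ (n + 1) * (2 * ((L : ℝ) * u + c₀)) ^ n * lamR ^ u ≤ (3 : ℝ) ^ (n + 1) * ((2 * (L : ℝ)) ^ n * C₁) := by
  have hlamu0 : 0 ≤ lamR ^ u := pow_nonneg hlam0 _
  have hL1r : (1 : ℝ) ≤ L := by exact_mod_cast hL1
  have hbase : 2 * ((L : ℝ) * u + c₀) ≤ 2 * (L : ℝ) * ((u : ℝ) + c₀) := by nlinarith
  have hyle : (3 : ℝ) ^ (n + 1) * (2 * ((L : ℝ) * u + c₀)) ^ n ≤
      (3 : ℝ) ^ (n + 1) * ((2 * (L : ℝ)) ^ n * (((u : ℝ) + c₀) ^ n)) := by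
    rw [← mul_pow]
    exact mul_le_mul_of_nonneg_left (pow_le_pow_left₀ (by positivity) hbase n) (by positivity)
  calc (3 : ℝ) ^ (n + 1) * (2 * ((L : ℝ) * u + c₀)) ^ n * lamR ^ u
      ≤ (3 : ℝ) ^ (n + 1) * ((2 * (L : ℝ)) ^ n * (((u : ℝ) + c₀) ^ n)) * lamR ^ u :=
        mul_le_mul_of_nonneg_right hyle hlamu0
    _ = (3 : ℝ) ^ (n + 1) * ((2 * (L : ℝ)) ^ n * ((((u : ℝ) + c₀) ^ n) * lamR ^ u)) := by ring
    _ ≤ (3 : ℝ) ^ (n + 1) * ((2 * (L : ℝ)) ^ n * C₁) :=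
        mul_le_mul_of_nonneg_left (mul_le_mul_of_nonneg_left (hC₁ u) (by positivity)) (by positivity)

set_option maxHeartbeats 3200000 in
/-- **Block B4 on lines (package level): the kernel second difference of `K_{k+1}` along `p, p+y, p+y+y` at the fixed intermediate
Hamiltonian `H̃_{q₀}`, `N`-free** (module docstring). [cite: AdamsBuchholzKoteckyMuller2019, Lemma 12.6 (12.53) / Theorem 6.8 / Lemma 8.4] -/
theorem exists_weakNormLE_blockB4_line (P : PackageData d) [Fact (0 < P.h)] [Fact (0 < P.L)] (hr0 : 0 < P.r) :
    ∃ l₄ : ℝ, 0 ≤ l₄ ∧ ∀ (N M : ℕ) [NeZero M] (Q : PackageAt P N M),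
      ∀ q₀ p y : Matrix (Fin d) (Fin d) ℝ, P.InBall q₀ → P.InBall p → P.InBall (p + y) → P.InBall (p + y + y) →
      ∀ k, k + 1 ≤ N →
      ∀ (u : HamSpace ℂ d (fieldWt P.h (P.L : ℝ) d k) ((P.L : ℝ) ^ k) (P.L ^ (d * k)))
        (v : activitySpace Q.normParams k) (cv : ℝ), ‖u‖ ≤ P.r →
        activityNormLE Q.normParams k v cv → cv ≤ P.r →
      WeakNormLE Q.normParams (k + 1)
        (fun X ψ =>
          nextK (abkmStepData P.L P.R k (Q.kernels (p + y + y))).s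
              (reblock (abkmStepData P.L P.R k (Q.kernels (p + y + y))).s
                ((abkmStepData P.L P.R k (Q.kernels (p + y + y))).L * (abkmStepData P.L P.R k (Q.kernels (p + y + y))).s))
              (stepMeasure (abkmStepData P.L P.R k (Q.kernels (p + y + y))).𝒞) (expNegH (HamSpace.toHam u))
              (expNegH (nextH (abkmStepData P.L P.R k (Q.kernels q₀)) (HamSpace.toHam u)
                (mulExt ((v : activitySpace Q.normParams k) : Finset (Fin d → ZMod M) → ((Fin d → ZMod M) → ℝ) → ℂ))))
              (mulExt ((v : activitySpace Q.normParams k) : Finset (Fin d → ZMod M) → ((Fin d → ZMod M) → ℝ) → ℂ)) X ψ -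
          nextK (abkmStepData P.L P.R k (Q.kernels (p + y))).s
              (reblock (abkmStepData P.L P.R k (Q.kernels (p + y))).s
                ((abkmStepData P.L P.R k (Q.kernels (p + y))).L * (abkmStepData P.L P.R k (Q.kernels (p + y))).s))
              (stepMeasure (abkmStepData P.L P.R k (Q.kernels (p + y))).𝒞) (expNegH (HamSpace.toHam u))
              (expNegH (nextH (abkmStepData P.L P.R k (Q.kernels q₀)) (HamSpace.toHam u)
                (mulExt ((v : activitySpace Q.normParams k) : Finset (Fin d → ZMod M) → ((Fin d → ZMod M) → ℝ) → ℂ))))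
              (mulExt ((v : activitySpace Q.normParams k) : Finset (Fin d → ZMod M) → ((Fin d → ZMod M) → ℝ) → ℂ)) X ψ -
          nextK (abkmStepData P.L P.R k (Q.kernels (p + y))).s
              (reblock (abkmStepData P.L P.R k (Q.kernels (p + y))).s
                ((abkmStepData P.L P.R k (Q.kernels (p + y))).L * (abkmStepData P.L P.R k (Q.kernels (p + y))).s))
              (stepMeasure (abkmStepData P.L P.R k (Q.kernels (p + y))).𝒞) (expNegH (HamSpace.toHam u))
              (expNegH (nextH (abkmStepData P.L P.R k (Q.kernels q₀)) (HamSpace.toHam u)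
                (mulExt ((v : activitySpace Q.normParams k) : Finset (Fin d → ZMod M) → ((Fin d → ZMod M) → ℝ) → ℂ))))
              (mulExt ((v : activitySpace Q.normParams k) : Finset (Fin d → ZMod M) → ((Fin d → ZMod M) → ℝ) → ℂ)) X ψ +
          nextK (abkmStepData P.L P.R k (Q.kernels p)).s
              (reblock (abkmStepData P.L P.R k (Q.kernels p)).s
                ((abkmStepData P.L P.R k (Q.kernels p)).L * (abkmStepData P.L P.R k (Q.kernels p)).s))
              (stepMeasure (abkmStepData P.L P.R k (Q.kernels p)).𝒞) (expNegH (HamSpace.toHam u))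
              (expNegH (nextH (abkmStepData P.L P.R k (Q.kernels q₀)) (HamSpace.toHam u)
                (mulExt ((v : activitySpace Q.normParams k) : Finset (Fin d → ZMod M) → ((Fin d → ZMod M) → ℝ) → ℂ))))
              (mulExt ((v : activitySpace Q.normParams k) : Finset (Fin d → ZMod M) → ((Fin d → ZMod M) → ℝ) → ℂ)) X ψ)
        (l₄ * esum y * esum y * max ‖u‖ cv) := by
  -- letters of the package
  set C87 := pi2BoundConst d (((2 * P.R + 2 : ℕ) : ℝ) + ((d / 2 + 1 : ℕ) : ℝ)) with hC87
  have hC87_0 : 0 ≤ C87 := pi2BoundConst_nonneg d (by positivity)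
  have hA0 : 0 < P.A := lt_of_lt_of_le one_pos P.hA1
  have hA𝒫0 : 0 ≤ P.A𝒫' := P.A𝒫'_nonneg
  set vr := vABKM d P.R P.A P.A𝒫' P.r with hvr
  have hvr' : vr = C87 * (P.r * P.A𝒫' * P.A⁻¹) := rfl
  have hvr0 : 0 ≤ vr := by rw [hvr']; exact mul_nonneg hC87_0 (by positivity)
  set τ := 2 * P.r + vr with hτdef
  have hτ0 : 0 < τ := by positivity
  have hτ364 : τ ≤ 3 / 64 := by
    have h1 : P.r ≤ 1 / 64 := P.hr
    have h2 : vr ≤ 1 / 64 := P.hv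
    rw [hτdef]; linarith
  set s := 16 * Real.exp (3 / 8) * τ with hsdef
  have hs0 : 0 < s := by positivity
  set κb := 1 + Real.exp (1 / 4) with hκbdef
  have hκb1 : 1 ≤ κb := by have := Real.exp_pos (1 / 4 : ℝ); linarith
  set κm := κb + s with hκmdef
  have hκm0 : 0 < κm := by linarith
  have hκA : kappaABKM d P.R P.A P.A𝒫' P.r = κm + s := by
    rw [hκmdef, hκbdef, hsdef, hτdef, hvr, kappaABKM_eq_mid_add]
  set κA := kappaABKM d P.R P.A P.A𝒫' P.r with hκAdef
  have hκA0 : 0 < κA := by rw [hκA]; linarith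
  have hκmA : κm ≤ κA := by rw [hκA]; linarith
  set ω := omegaABKM d P.R P.A P.A𝒫' P.r with hωdef
  have hω : ω = 8 * Real.exp (1 / 4) * τ + 2 * s := by
    rw [hωdef, hsdef, hτdef, hvr]; unfold omegaABKM; ring
  -- the room parameter `ε` and the line supplier
  set ε := s / (4 * (κb + s)) with hεdef
  have hε0 : 0 < ε := by positivity
  have hκmε : κm * ε = s / 4 := by
    rw [hεdef, hκmdef]; field_simp
  have hε1 : ε ≤ 1 / 4 := by
    rw [hεdef, div_le_iff₀ (by positivity)]; nlinarith only [hs0, hκb1]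
  obtain ⟨ℓn, κp, hℓn0, hκp0, hκpε, hsup⟩ := P.exists_lineSecondPairSupplier hε0
  -- the geometric room `lam₀ = κ_mid (1+ε) / κ_A < 1` and `lamR = lam₀^{cL^d}`
  set lam₀ := κm * (1 + ε) / κA with hlam₀def
  have hlam₀0 : 0 < lam₀ := by positivity
  have hlam₀1 : lam₀ < 1 := by
    rw [hlam₀def, div_lt_one hκA0, hκA]; nlinarith only [hκmε, hs0, hκm0]
  have hlamκ : lam₀ * κA = κm * (1 + ε) := by
    rw [hlam₀def]; field_simp
  set cN := (2 ^ (d + 1) + 2) ^ d * P.L ^ d with hcNdef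
  have hcN1 : 1 ≤ cN := Nat.one_le_iff_ne_zero.2 (mul_ne_zero (pow_ne_zero _ (by positivity)) (pow_ne_zero _ P.hLodd.pos.ne'))
  set lamR := lam₀ ^ cN with hlamRdef
  have hlamR0 : 0 < lamR := pow_pos hlam₀0 _
  have hlamR1 : lamR < 1 := pow_lt_one₀ hlam₀0.le hlam₀1 (by omega)
  -- the counting conditions at the smaller letter `κ_mid`, with room
  have hmm2 : κm * max 1 (max P.A𝒫' κp) ≤ lam₀ * (κA * max 1 P.A𝒫') := by
    have hm0 : 0 ≤ max 1 P.A𝒫' := le_trans zero_le_one (le_max_left _ _)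
    have h1 : max 1 (max P.A𝒫' κp) ≤ (1 + ε) * max 1 P.A𝒫' := by
      refine max_le ?_ (max_le ?_ ?_)
      · have : (1 : ℝ) ≤ max 1 P.A𝒫' := le_max_left _ _
        nlinarith only [this, hε0]
      · have : P.A𝒫' ≤ max 1 P.A𝒫' := le_max_right _ _
        nlinarith only [this, hε0, hA𝒫0]
      · have : P.A𝒫' ≤ max 1 P.A𝒫' := le_max_right _ _
        nlinarith only [this, hε0, hA𝒫0, hκpε, hm0]
    calc κm * max 1 (max P.A𝒫' κp) ≤ κm * ((1 + ε) * max 1 P.A𝒫') :=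
          mul_le_mul_of_nonneg_left h1 hκm0.le
      _ = lam₀ * (κA * max 1 P.A𝒫') := by rw [← mul_assoc, ← hlamκ]; ring
  have hc3b : κm ^ (P.L ^ d) * ((2 * (2 * κm * max 1 (max P.A𝒫' κp))) ^ ((2 ^ (d + 1) + 2) ^ d * P.L ^ d) * (4 : ℝ) ^ ((2 ^ (d + 1) + 2) ^ d * P.L ^ d)) ≤ lamR * P.A ^ ((1 + 1 / ((2 * (2 ^ d + 1) + 6 : ℝ) ^ d)) - 1 : ℝ) := (c3Const_ratio hκm0.le hκmA hmm2 _ _).trans (mul_le_mul_of_nonneg_left P.hc3A (pow_nonneg hlam₀0.le _))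
  have hc2b : κm ^ (P.L ^ d) * ((2 * κm * max 1 (max P.A𝒫' κp)) ^ ((2 ^ (d + 1) + 2) ^ d * P.L ^ d) * (2 : ℝ) ^ ((2 ^ (d + 1) + 2) ^ d * P.L ^ d)) ≤ lamR * P.A ^ ((1 + 1 / ((2 * (2 ^ d + 1) + 6 : ℝ) ^ d)) - 1 : ℝ) := (c2Const_ratio hκm0.le hκmA hmm2 _ _).trans (mul_le_mul_of_nonneg_left P.hc2A (pow_nonneg hlam₀0.le _))
  -- the polynomial of the near supplier is absorbed by `lamR^{|U|_{k+1}}`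
  set c₀ : ℝ := ((2 * (2 ^ (d + 1) + P.R) + 2 * P.pT + 1 : ℕ) : ℝ) with hc₀def
  have hc₀0 : 0 ≤ c₀ := Nat.cast_nonneg _
  obtain ⟨C₁, hC₁0, hC₁⟩ := exists_nat_add_pow_mul_pow_le hlamR0 hlamR1 hc₀0 d
  set Cn : ℝ := (3 : ℝ) ^ (d + 1) * ((2 * (P.L : ℝ)) ^ d * C₁) with hCndef
  have hCn0 : 0 ≤ Cn := by positivity
  -- the size
  have hLpos : 0 < P.L := P.hLodd.pos
  have hL0r : (0 : ℝ) < P.L := by exact_mod_cast hLpos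
  have hAinv0 : 0 ≤ P.A⁻¹ := inv_nonneg.2 hA0.le
  have hlaminv0 : 0 ≤ lamR⁻¹ := inv_nonneg.2 hlamR0.le
  have hω0 : 0 ≤ ω := by rw [hω]; positivity
  set lN : ℝ := (2 * ((P.L ^ d : ℕ) : ℝ) * (Real.exp (1 / 4) ^ (P.L ^ d) * Real.exp (1 / 4)) *
      ((8 * Real.exp (1 / 4) + P.A⁻¹) * (ℓn * Cn * lamR⁻¹) * κp)) * P.A +
    ℓn * Cn * ((8 * Real.exp (1 / 4) + 1) * (ω * P.A ^ 4) + 1) +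
    ℓn * Cn * ((8 * Real.exp (1 / 4) + 1) * (ω * P.A ^ 4)) +
    ℓn * Cn * ((8 * Real.exp (1 / 4) + 1) * (ω * P.A ^ 4)) with hlNdef
  have hlN0 : 0 ≤ lN := by rw [hlNdef]; positivity
  refine ⟨lN, hlN0, fun N M _ Q => ?_⟩
  intro q₀ p y hq₀ hp hpy hpyy k hk u v cv hu hv hcv
  -- sizes
  have hd2 : 2 ≤ d := le_trans (by norm_num) P.hd
  have hL1 : 1 ≤ P.L := P.hLodd.pos
  have hPA : 0 < Q.normParams.A := P.A_pos
  have hk1 : 1 ≤ P.L ^ k := Nat.one_le_pow _ _ P.hLodd.pos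
  have hMt : M = Q.normParams.L ^ k * P.L ^ (N - k) := by
    show M = P.L ^ k * P.L ^ (N - k)
    rw [Q.hM, ← pow_add, Nat.add_sub_cancel' (by omega)]
  have hcv0 : 0 ≤ cv := nonneg_of_weakNormLE hPA hMt P.hLodd.pow P.hLodd.pow hv
  set t := esum y with htdef
  have ht0 : 0 ≤ t := entrySum_nonneg _
  set mx := max ‖u‖ cv with hmxdef
  have hmx0 : 0 ≤ mx := le_max_of_le_left (norm_nonneg _)
  have hmxr : mx ≤ P.r := max_le hu hcv
  have hm64 : mx ≤ 1 / 64 := hmxr.trans P.hr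
  -- the state
  set H := HamSpace.toHam u with hHdef
  set Kf := mulExt ((v : activitySpace Q.normParams k) :
    Finset (Fin d → ZMod M) → ((Fin d → ZMod M) → ℝ) → ℂ) with hKfdef
  have hnormu : hamNorm (fieldWt P.h (P.L : ℝ) d k) ((P.L : ℝ) ^ k) (P.L ^ (d * k)) H = ‖u‖ := by
    rw [hHdef, HamSpace.norm_def]
  have hHm : hamNorm (fieldWt P.h (P.L : ℝ) d k) ((P.L : ℝ) ^ k) (P.L ^ (d * k)) H ≤ mx := by
    rw [hnormu]; exact le_max_left _ _
  have hKw : WeakNormLE Q.normParams k Kf cv := activitySpace.weakNormLE_mulExt v hv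
  have hKm : WeakNormLE Q.normParams k Kf mx := hKw.mono hPA (le_max_right _ _)
  have hKd : ∀ Y, ContDiff ℝ P.r₀ (Kf Y) := activitySpace.contDiff_mulExt v
  have hKloc : ∀ Y, IsPolymer (P.L ^ k) Y → IsConn Y → IsGaugeLocal (Q.normParams.gauge k Y) (Kf Y) :=
    fun Y hY hYc => activitySpace.isGaugeLocal_mulExt v hY hYc
  -- the step kernels at the three points of the line and at `q₀`
  have hSa := packageAt_stepKernelBounds P Q hpyy hk
  have hSb := packageAt_stepKernelBounds P Q hpy hk
  have hSe := packageAt_stepKernelBounds P Q hp hk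
  have hS₀ := packageAt_stepKernelBounds P Q hq₀ hk
  set D₀ := abkmStepData P.L P.R k (Q.kernels q₀) with hD₀
  -- the line supplier at `(p, y)`
  have hdiffU := hsup N M Q p y hp hpy hpyy k hk
  set ℓnf : Finset (Fin d → ZMod M) → ℝ := fun U => ℓn * esum y * esum y *
    ((3 : ℝ) ^ (d + 1) * ((2 * (P.L * numBlocks (P.L ^ (k + 1)) U + 2 * (2 ^ (d + 1) + P.R) + 2 * P.pT + 1) : ℕ) : ℝ) ^ d)
    with hℓnfdef
  have hℓnf0 : ∀ U, 0 ≤ ℓnf U := fun U => by rw [hℓnfdef]; positivity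
  have hℓnf : ∀ U : Finset (Fin d → ZMod M), ℓnf U * lamR ^ (blocks (P.L * P.L ^ k) U).card ≤ ℓn * Cn * (t * t) := by
    intro U
    have hcard : (blocks (P.L * P.L ^ k) U).card = numBlocks (P.L ^ (k + 1)) U := by
      rw [card_blocks_eq_numBlocks, ← pow_succ']
    rw [hcard, hℓnfdef]
    have hcast : ((2 * (P.L * numBlocks (P.L ^ (k + 1)) U + 2 * (2 ^ (d + 1) + P.R) + 2 * P.pT + 1) : ℕ) : ℝ) =
        2 * ((P.L : ℝ) * (numBlocks (P.L ^ (k + 1)) U) + c₀) := by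
      rw [hc₀def]; push_cast; ring
    have hpl := poly_mul_geom_le_blockB4 hL1 hc₀0 hlamR0.le hC₁ (numBlocks (P.L ^ (k + 1)) U)
    rw [← hcast] at hpl
    calc ℓn * esum y * esum y * ((3 : ℝ) ^ (d + 1) *
            ((2 * (P.L * numBlocks (P.L ^ (k + 1)) U + 2 * (2 ^ (d + 1) + P.R) + 2 * P.pT + 1) : ℕ) : ℝ) ^ d) *
          lamR ^ numBlocks (P.L ^ (k + 1)) U
        = ℓn * (t * t) * ((3 : ℝ) ^ (d + 1) *
            ((2 * (P.L * numBlocks (P.L ^ (k + 1)) U + 2 * (2 ^ (d + 1) + P.R) + 2 * P.pT + 1) : ℕ) : ℝ) ^ d *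
          lamR ^ numBlocks (P.L ^ (k + 1)) U) := by rw [htdef]; ring
      _ ≤ ℓn * (t * t) * Cn := mul_le_mul_of_nonneg_left hpl (by positivity)
      _ = ℓn * Cn * (t * t) := by ring
  -- the carriers and letters
  have hτm : 2 * mx + C87 * (mx * P.A𝒫' * P.A⁻¹) ≤ τ := by
    have : C87 * (mx * P.A𝒫' * P.A⁻¹) ≤ vr := by
      rw [hvr']
      exact mul_le_mul_of_nonneg_left (mul_le_mul_of_nonneg_right
        (mul_le_mul_of_nonneg_right hmxr hA𝒫0) (inv_nonneg.2 hA0.le)) hC87_0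
    rw [hτdef]; linarith only [this, hmxr]
  have hτ16 : τ ≤ 1 / 16 := by linarith only [hτ364]
  have hexp14 : 1 ≤ Real.exp (1 / 4 : ℝ) := Real.one_le_exp (by norm_num)
  have hL0r' : (0 : ℝ) < P.L := by exact_mod_cast P.hLodd.pos
  have h𝔥 : 0 < fieldWt P.h (P.L : ℝ) d k := fieldWt_pos P.hh hL0r' d k
  have hRk : (0 : ℝ) < (P.L : ℝ) ^ k := pow_pos hL0r' k
  have hHr : hamNorm (fieldWt P.h (P.L : ℝ) d k) ((P.L : ℝ) ^ k) (P.L ^ (d * k)) H ≤ P.r := by rw [hnormu]; exact hu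
  have hKr : WeakNormLE Q.normParams k Kf P.r := hKw.mono hPA hcv
  -- `‖H̃_{q₀}‖ ≤ τ`
  have hHta : hamNorm (fieldWt P.h (P.L : ℝ) d k) ((P.L : ℝ) ^ k) (P.L ^ (d * k)) (nextH D₀ H Kf) ≤ τ := by
    have h := hamNorm_nextH_abkm_le_of_stepKernelBounds hd2 P.hLodd P.hL Q.hM hk (by have := P.hp; omega)
      (by have := P.hpM; have := P.hMR; omega) (by have := P.hr₀; omega) Q.hB P.hh P.hh2 P.hA1 D₀ hS₀ (x₀ := 0) rfl rfl H
      P.hr0 hKr hKd hKloc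
    rw [hτdef, hvr']
    linarith [h, hHr]
  have hω1 : 8 * Real.exp (1 / 4) * τ ≤ ω := by rw [hω]; linarith [hs0]
  have hκ' : 1 + Real.exp (1 / 4) ≤ κm := by rw [hκmdef, hκbdef]; linarith [hs0]
  have hω2 : 8 * Real.exp (1 / 4) * mx + 8 * Real.exp (1 / 4) * mx ≤ ω := by
    rw [hω]
    have h1 : 8 * Real.exp (1 / 4) * mx ≤ 8 * Real.exp (1 / 4) * P.r := by gcongr
    have h2 : 2 * P.r ≤ τ := by rw [hτdef]; linarith only [hvr0]
    have h3 : 0 ≤ Real.exp (1 / 4 : ℝ) := (Real.exp_pos _).le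
    have h4 : 8 * Real.exp (1 / 4) * (2 * P.r) ≤ 8 * Real.exp (1 / 4) * τ := mul_le_mul_of_nonneg_left h2 (by positivity)
    nlinarith only [h1, h4, hs0, h3]
  have hω3 : mx + mx ≤ ω := by
    rw [hω]
    have h2 : 2 * P.r ≤ τ := by rw [hτdef]; linarith only [hvr0]
    have h4 : τ ≤ 8 * Real.exp (1 / 4) * τ := by nlinarith only [hexp14, hτ0]
    linarith only [hmxr, h2, h4, hs0]
  -- the kernel-level weak bound for the four kernels `p+y+y, p+y, p+y, p` at `H̃ = H̃_{q₀}`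
  have hW := weakNormLE_nextK_freeHt_kernelSecondDiff_abkm_of_stepKernelBounds P.hd P.hLodd P.hL P.hR2 Q.hM hk
    (by have := P.hp; omega) (by have := P.hpM; have := P.hMR; omega) Q.hB P.hδ₀ P.hδ₁ P.hh P.hh0 P.A𝒫'_nonneg P.hA1
    hSa hSb hSb hSe hκp0 (ℓnf := ℓnf) (ℓbar := ℓn * Cn * (t * t)) (lamR := lamR) hℓnf0 hℓnf hlamR0 hlamR1.le hdiffU
    hHm hm64 hmx0 hKm (factorises_mulExt hk1) (fun φ => mulExt_empty φ) hKd hKloc hτ16 hHta (ω := ω) (κ := κm)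
    hω1 hω2 hω3 P.hωA hκ' hc3b hc2b
  refine hW.mono hPA ?_
  -- every term carries a factor `t · t · max(‖u‖, c_v)`
  refine le_trans (b := (2 * ((P.L ^ d : ℕ) : ℝ) * (Real.exp (1 / 4) ^ (P.L ^ d) * Real.exp (1 / 4)) *
      ((8 * Real.exp (1 / 4) * mx + mx * P.A⁻¹) * (ℓn * Cn * (t * t) * lamR⁻¹) * κp)) * P.A +
    ℓn * Cn * (t * t) * ((8 * Real.exp (1 / 4) * mx + mx) * (ω * P.A ^ 4) + mx) +
    ℓn * Cn * (t * t) * ((8 * Real.exp (1 / 4) * mx + mx) * (ω * P.A ^ 4)) +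
    ℓn * Cn * (t * t) * ((8 * Real.exp (1 / 4) * mx + mx) * (ω * P.A ^ 4))) ?_ (le_of_eq ?_)
  · gcongr
  · rw [hlNdef, htdef]; ring

end Summit.HubbardSuperconductivity.HubbardSuperconductivity.Theorems.ComplexGFF

end
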